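import Literature.NumberTheory.Sieve.GoldbachLinnikSeven

/-!
# Goldbach–Linnik with `K = 6`: the floor of the Pintz–Ruzsa method with the constants in print,
and the two hypothetical levers

Topic `Literature/NumberTheory/Sieve`. Sequel to `GoldbachLinnikSeven.lean`, whose
`GoldbachLinnik.goldbach_linnik_with_of_analytic_inputs` proves Pintz–Ruzsa I §10 (10.10)–(10.16) for two
moment indices `(i, j)` from the analytic inputs, with criterion
`(A(i) + C λ^{2i-2})(A(j) + C λ^{2j-2}) < 1`. This file records what that criterion says at
`(i, j) = (3, 3)`, i.e. `K = 6`, which is the content of the "K = 6" row of Johnston–Trudgian's table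
("the value of `C₁` required … `K = 6`, no GRH: `5.672`", arXiv:2605.17825v2, Table `PRtable`) and of the
honest FLOOR statement of the reproduce-first cell `papers/Parity/linnik-goldbach-7` (K6.md):

**THIS IS NOT A ROUTE TO GOLDBACH, and `K = 6` is NOT claimed.** Unconditionally the record in print is
`K = 8` (Pintz–Ruzsa II 2020); `K = 6` is known under GRH only (Johnston–Trudgian 2026, Thm 1.1, improving
Heath-Brown–Puchta / Pintz–Ruzsa's GRH `K = 7`). What is PROVED here is arithmetic plus two instances of the
tree theorem `goldbach_linnik_with_of_analytic_inputs`: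

* §1 FLOOR (all `[folklore]` arithmetic). With the large-deviation constant of Pintz–Ruzsa I, Corollary 2,
  `λ = c₁ = 0.789401` (the best value in print at minor-arc measure `N^{-3/5}`), the `K = 6` quantity
  `A(3) + C λ⁴` is `≥ 1` for EVERY `A(3) ≥ 0` as soon as the minor-arc mean-square constant satisfies
  `C ≥ 2.576` (`crit33_not_lt_one`) — and every `C` available is larger: `4.0826` (Pintz–Ruzsa II Lemma 5 with
  Chen's `3.9171`), `≈ 3.403` (the same lemma with Lichtman's preprint `3.3907`), `3.1644–3.1697` (the in-house
  graded profile, under adjudication). Equivalently the criterion NEEDS `C < 2.576` (`crit33_needs_C_lt`), or,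
  inside the shape `C = C₀R₀(C* − 1) + (1 − ϑ)(log 2)/2` of Pintz–Ruzsa II Lemma 5 / Johnston–Trudgian (C2def1)
  with `C₀ ≥ 0.66016`, `R₀ ≥ 1.93642` (Platt–Trudgian), level `ϑ ≤ 4/9`, a pair-sieve constant `C* < 2.865`
  (`crit33_needs_Cstar_lt`; Johnston–Trudgian print the sufficient value `C₁ = 2C* = 5.672`); or, granting even
  the smallest `C` anyone has claimed (`3.1644`), a lacunary constant `λ < 0.7498` (`crit33_needs_lam_lt`).
  No verification range enters: the floor is set by the analytic constants `c₁`, `C*` (equivalently `C`), `A(3)`.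
* §2 THE TWO LEVERS, as CONDITIONAL frames over the typed inputs (every analytic input a hypothesis, exactly as
  in `goldbach_linnik_seven_of_analytic_inputs`): `goldbach_linnik_six_of_analytic_inputs_of_lam_le` — the
  flat-Lichtman constant AS PRINTED in the Lemma-5 shape (`C ≤ C₀R₀(3.3907 − 1) + (log 2)/2`, `C₀R₀ ≤ 1.2784422`)
  together with a HYPOTHETICAL lacunary constant `λ ≤ 0.7337` gives `K = 6`; and
  `goldbach_linnik_six_of_analytic_inputs_of_Cstar_le` — the printed `λ ≤ 0.789401` together with a
  HYPOTHETICAL pair-sieve constant `C* ≤ 2.835` at level `4/9` gives `K = 6` (this is the `K = 6` row of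
  Johnston–Trudgian's table, `C₁ ≤ 5.672`, certified with inward rounding). Neither hypothetical value is
  known or claimed anywhere; the best pair-sieve constants are `3.9171` (Chen 1978, print) and `3.3907`
  (Lichtman 2023, preprint), the best lacunary constant at the required measure is `0.7894` (print) resp.
  `0.7778 = d(7/12)` if the minor-arc exponent `19/24` of Maynard–Pandey–Radziwiłł (preprint 2026) is used —
  still far from `0.7337`.

## References

* J. Pintz, I. Z. Ruzsa, *On Linnik's approximation to Goldbach's problem, I*, Acta Arith. 109 (2003)
  169–194: §10 (10.10)–(10.16), Corollary 2 (`c₁ = 0.7894…`), (8.14) (`1.936 < R₀ < 1.94`). [PintzRuzsa2003]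
* J. Pintz, I. Z. Ruzsa, *On Linnik's approximation to Goldbach's problem. II*, Acta Math. Hungar. 161 (2020)
  569–582: Lemma 5 (`C₂' < 4.0826`), §6 (`K = 8`). [PintzRuzsa2020]
* D. R. Johnston, T. Trudgian, *An update on the Linnik–Goldbach and Romanov problems*, arXiv:2605.17825v2
  (2026): Thm 1.1 (`K = 6` under GRH), (C2def1), (R0bounds) `1.93642 < R₀ < 1.93656`, Table `PRtable`
  (`C₁` required for `K = 6`: `5.672`). [JohnstonTrudgian2026]
-/

noncomputable section

open scoped Topology

open Finset Filter MeasureTheory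

namespace Literature.NumberTheory.Sieve

namespace GoldbachLinnik

/-! ### §1 The floor at `K = 6` with the constants in print -/

/-- **Floor of the method at `K = 6`.** For every `A₃ ≥ 0`, every mean-square constant `C ≥ 2.576` and every
lacunary constant `λ ≥ 0.789401` (Pintz–Ruzsa I, Cor. 2, the value in print), the `(3, 3)` criterion quantity
is NOT `< 1`: `(A₃ + Cλ⁴)² ≥ 1` (indeed `2.576 · 0.789401⁴ > 1.0003`). [folklore] -/
theorem crit33_not_lt_one {A₃ C lam : ℝ} (hA : 0 ≤ A₃) (hC : 2.576 ≤ C) (hlam : 0.789401 ≤ lam) :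
    ¬ (A₃ + C * lam ^ (2 * 3 - 2)) * (A₃ + C * lam ^ (2 * 3 - 2)) < 1 := by
  have hl4 : (0.789401 : ℝ) ^ 4 ≤ lam ^ 4 := pow_le_pow_left₀ (by norm_num) hlam 4
  have hCl : (2.576 : ℝ) * 0.789401 ^ 4 ≤ C * lam ^ 4 :=
    mul_le_mul hC hl4 (by norm_num) (by linarith)
  have key : (1 : ℝ) ≤ A₃ + C * lam ^ 4 := by
    have : (1 : ℝ) ≤ (2.576 : ℝ) * 0.789401 ^ 4 := by norm_num
    linarith
  have h4 : (2 * 3 - 2 : ℕ) = 4 := by norm_num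
  rw [h4, not_lt]
  exact one_le_mul_of_one_le_of_one_le key key

/-- The `K = 6` criterion with `λ ≥ 0.789401` (print) and any `A₃ ≥ 0` NEEDS a mean-square constant
`C < 2.576` (`= 1/0.789401⁴` rounded up); Pintz–Ruzsa II Lemma 5 gives `4.0826`. [folklore] -/
theorem crit33_needs_C_lt {A₃ C lam : ℝ} (hA : 0 ≤ A₃) (hlam : 0.789401 ≤ lam)
    (h : (A₃ + C * lam ^ (2 * 3 - 2)) * (A₃ + C * lam ^ (2 * 3 - 2)) < 1) : C < 2.576 := by
  by_contra hcon
  rw [not_lt] at hcon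
  exact crit33_not_lt_one hA hcon hlam h

/-- The `K = 6` criterion with `λ ≥ 0.789401`, any `A₃ ≥ 0`, and a mean-square constant of the
Pintz–Ruzsa II Lemma 5 / Johnston–Trudgian (C2def1) shape `C ≥ C₀R₀(C* − 1) + (1 − ϑ)(log 2)/2` with
`C₀ ≥ 0.66016` (twin-prime-constant factor), `R₀ ≥ 1.93642` (Platt–Trudgian, as quoted in Johnston–Trudgian
(R0bounds)) and major-arc level `ϑ ≤ 4/9`, NEEDS a pair-sieve constant `C* < 2.865`. Johnston–Trudgian's
table prints the matching sufficient value `C₁ = 2C* = 5.672`; the best constants are `3.9171` (Chen, print)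
and `3.3907` (Lichtman, preprint). [folklore] -/
theorem crit33_needs_Cstar_lt {A₃ C lam C0 R0 Cstar ϑ : ℝ} (hA : 0 ≤ A₃) (hlam : 0.789401 ≤ lam)
    (hC0 : 0.66016 ≤ C0) (hR0 : 1.93642 ≤ R0) (hϑ : ϑ ≤ 4 / 9) (hCs : 1 ≤ Cstar)
    (hC : C0 * R0 * (Cstar - 1) + Real.log 2 / 2 * (1 - ϑ) ≤ C)
    (h : (A₃ + C * lam ^ (2 * 3 - 2)) * (A₃ + C * lam ^ (2 * 3 - 2)) < 1) : Cstar < 2.865 := by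
  have hC' : C < 2.576 := crit33_needs_C_lt hA hlam h
  have hl : 0.6931471803 < Real.log 2 := Real.log_two_gt_d9
  have h1 : (0.66016 : ℝ) * 1.93642 * (Cstar - 1) ≤ C0 * R0 * (Cstar - 1) := by
    have : (0.66016 : ℝ) * 1.93642 ≤ C0 * R0 := mul_le_mul hC0 hR0 (by norm_num) (by linarith)
    exact mul_le_mul_of_nonneg_right this (by linarith)
  have h2 : (0.6931471803 : ℝ) / 2 * (5 / 9) ≤ Real.log 2 / 2 * (1 - ϑ) := by nlinarith
  nlinarith

/-- Granting even the smallest mean-square constant anyone has claimed (`C ≥ 3.1644`, the in-house graded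
value under adjudication; every constant in print is larger) and any `A₃ ≥ 0`, the `K = 6` criterion NEEDS a
lacunary (large-deviation) constant `λ < 0.7498`; in print `λ = 0.7894` (Pintz–Ruzsa I, Cor. 2), and
`0.7778 = d(7/12)` with the preprint minor-arc exponent `19/24`. [folklore] -/
theorem crit33_needs_lam_lt {A₃ C lam : ℝ} (hA : 0 ≤ A₃) (hC : 3.1644 ≤ C)
    (h : (A₃ + C * lam ^ (2 * 3 - 2)) * (A₃ + C * lam ^ (2 * 3 - 2)) < 1) : lam < 0.7498 := by
  by_contra hcon
  rw [not_lt] at hcon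
  have hl4 : (0.7498 : ℝ) ^ 4 ≤ lam ^ 4 := pow_le_pow_left₀ (by norm_num) hcon 4
  have hCl : (3.1644 : ℝ) * 0.7498 ^ 4 ≤ C * lam ^ 4 :=
    mul_le_mul hC hl4 (by norm_num) (by linarith)
  have key : (1 : ℝ) ≤ A₃ + C * lam ^ 4 := by
    have : (1 : ℝ) ≤ (3.1644 : ℝ) * 0.7498 ^ 4 := by norm_num
    linarith
  have h4 : (2 * 3 - 2 : ℕ) = 4 := by norm_num
  rw [h4] at h
  exact absurd h (not_lt.mpr (one_le_mul_of_one_le_of_one_le key key))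

/-! ### §2 The two hypothetical levers, as conditional frames -/

/-- Lever 1 (numerics): with `A₃ ≤ 0.013598` (Khalfalah–Pintz), the flat-Lichtman mean-square constant in the
printed Lemma-5 shape `C ≤ C₀R₀(3.3907 − 1) + (log 2)/2`, `C₀R₀ ≤ 1.2784422`, and a HYPOTHETICAL lacunary constant
`λ ≤ 0.7337`, the `(3, 3)` criterion holds (corner value `< 0.9995`). [folklore] -/
theorem crit33_lt_one_of_lam_le {A₃ C C0R0 lam : ℝ} (hA3le : A₃ ≤ 0.013598) (hA3nn : 0 ≤ A₃)
    (hCR : C0R0 ≤ 1.2784422) (hCle : C ≤ C0R0 * ((3.3907 : ℝ) - 1) + Real.log 2 / 2) (hCnn : 0 ≤ C)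
    (hlamle : lam ≤ 0.7337) (hlamnn : 0 ≤ lam) :
    (A₃ + C * lam ^ (2 * 3 - 2)) * (A₃ + C * lam ^ (2 * 3 - 2)) < 1 := by
  have hl : Real.log 2 < 0.6931471808 := Real.log_two_lt_d9
  have hCle' : C ≤ 3.402946 := by nlinarith
  have hl4 : lam ^ 4 ≤ (0.7337 : ℝ) ^ 4 := pow_le_pow_left₀ hlamnn hlamle 4
  have hCl : C * lam ^ 4 ≤ (3.402946 : ℝ) * 0.7337 ^ 4 :=
    mul_le_mul hCle' hl4 (by positivity) (by norm_num)
  have hval : A₃ + C * lam ^ 4 < 1 := by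
    have : (0.013598 : ℝ) + (3.402946 : ℝ) * 0.7337 ^ 4 < 1 := by norm_num
    linarith
  have hnn : 0 ≤ A₃ + C * lam ^ 4 := by positivity
  have h4 : (2 * 3 - 2 : ℕ) = 4 := by norm_num
  rw [h4]
  exact mul_lt_one_of_nonneg_of_lt_one_left hnn hval hval.le

/-- Lever 2 (numerics): with `A₃ ≤ 0.013598`, the printed lacunary constant `λ ≤ 0.789401`, `C₀R₀ ≤ 1.2784422`,
and a HYPOTHETICAL pair-sieve constant `C* ≤ 2.835` in the Lemma-5 / (C2def1) shape at major-arc level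
`P = N^{4/9 − 10⁻⁴}` (`C ≤ C₀R₀(C* − 1) + (5/9 + 10⁻⁴)(log 2)/2`), the `(3, 3)` criterion holds (corner value
`< 0.9994`). This is the `K = 6`, no-GRH entry `C₁ = 5.672 (= 2 × 2.836)` of Johnston–Trudgian's table, certified
with inward rounding. [cite: JohnstonTrudgian2026, Table PRtable (K = 6, C₁ required 5.672)] -/
theorem crit33_lt_one_of_Cstar_le {A₃ C C0R0 Cstar lam : ℝ} (hA3le : A₃ ≤ 0.013598) (hA3nn : 0 ≤ A₃)
    (hCR : C0R0 ≤ 1.2784422) (hCRnn : 0 ≤ C0R0) (hCs : Cstar ≤ 2.835)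
    (hCle : C ≤ C0R0 * (Cstar - 1) + Real.log 2 / 2 * (5 / 9 + 1 / 10 ^ 4)) (hCnn : 0 ≤ C)
    (hlamle : lam ≤ 0.789401) (hlamnn : 0 ≤ lam) :
    (A₃ + C * lam ^ (2 * 3 - 2)) * (A₃ + C * lam ^ (2 * 3 - 2)) < 1 := by
  have hl : Real.log 2 < 0.6931471808 := Real.log_two_lt_d9
  have h1 : C0R0 * (Cstar - 1) ≤ 1.2784422 * 1.835 := by
    have := mul_le_mul_of_nonneg_left (by linarith : Cstar - 1 ≤ 1.835) hCRnn
    nlinarith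
  have hCle' : C ≤ 2.538556 := by nlinarith
  have hl4 : lam ^ 4 ≤ (0.789401 : ℝ) ^ 4 := pow_le_pow_left₀ hlamnn hlamle 4
  have hCl : C * lam ^ 4 ≤ (2.538556 : ℝ) * 0.789401 ^ 4 :=
    mul_le_mul hCle' hl4 (by positivity) (by norm_num)
  have hval : A₃ + C * lam ^ 4 < 1 := by
    have : (0.013598 : ℝ) + (2.538556 : ℝ) * 0.789401 ^ 4 < 1 := by norm_num
    linarith
  have hnn : 0 ≤ A₃ + C * lam ^ 4 := by positivity
  have h4 : (2 * 3 - 2 : ℕ) = 4 := by norm_num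
  rw [h4]
  exact mul_lt_one_of_nonneg_of_lt_one_left hnn hval hval.le

/-- **Lever 1 as a conditional frame: `K = 6` from the typed analytic inputs IF the lacunary constant were
`λ ≤ 0.7337`.** Same hypotheses as `goldbach_linnik_seven_of_analytic_inputs` (flat Lichtman constant in the
printed Lemma-5 shape, abstract minor-arc sup bound), at `(i, j) = (3, 3)`, with the large-deviation hypothesis
`hG` at a HYPOTHETICAL constant `λ ≤ 0.7337` (in print: `0.7894`; nothing of the kind is known or claimed).
Every analytic input is a hypothesis; the theorem proves bookkeeping and `crit33_lt_one_of_lam_le` only.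
[cite: PintzRuzsa2003, §10 (10.10)–(10.16), Lemma 13] -/
theorem goldbach_linnik_six_of_analytic_inputs_of_lam_le {𝔐 E : ℕ → Set ℝ}
    (h𝔐 : ∀ N, MeasurableSet (𝔐 N)) (hE : ∀ N, MeasurableSet (E N)) {U : ℕ → ℝ}
    {A₃ C C0R0 lam Cerr : ℝ} (hA3le : A₃ ≤ 0.013598) (hA3nn : 0 ≤ A₃)
    (hCR : C0R0 ≤ 1.2784422) (hCle : C ≤ C0R0 * ((3.3907 : ℝ) - 1) + Real.log 2 / 2)
    (hCnn : 0 ≤ C) (hlamle : lam ≤ 0.7337) (hlamnn : 0 ≤ lam)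
    (hM : ∀ᶠ N : ℕ in atTop, ∀ m : ℤ, m ≠ 0 → Even m →
      majorArcPairIntegral (𝔐 N) N m ≤
        goldbachSingularSeries m.natAbs * N / Real.log N ^ 2 + Cerr * N / Real.log N ^ 3)
    (hA3 : ∀ ε : ℝ, 0 < ε → ∀ᶠ N : ℕ in atTop,
      pairSingularSum N 3 ≤ (1 + A₃ + ε) * (2 * (powLen N : ℝ) ^ (2 * 3)))
    (hS : ∀ᶠ N : ℕ in atTop, ∀ α ∈ Set.Icc (0 : ℝ) 1 \ 𝔐 N, ‖primeSum N α‖ ≤ U N)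
    (hEU : ∀ ε : ℝ, 0 < ε → ∀ᶠ N : ℕ in atTop,
      (volume (E N ∩ Set.Icc (0 : ℝ) 1)).toReal * U N ^ 2 ≤ ε * N / Real.log N ^ 2)
    (hG : ∀ᶠ N : ℕ in atTop, ∀ α ∈ Set.Icc (0 : ℝ) 1 \ E N, ‖powSum N α‖ ≤ lam * powLen N)
    (hCi : ∀ ε : ℝ, 0 < ε → ∀ᶠ N : ℕ in atTop,
      ∫ α in Set.Icc (0 : ℝ) 1 \ 𝔐 N, ‖primeSum N α * powSum N α‖ ^ 2 ≤
        (C + ε) * (2 * N * (powLen N : ℝ) ^ 2 / Real.log N ^ 2)) :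
    goldbach_linnik_with 6 :=
  goldbach_linnik_with_of_analytic_inputs (i := 3) (j := 3) (by norm_num) (by norm_num) h𝔐 hE
    hA3nn hA3nn hCnn hlamnn
    (crit33_lt_one_of_lam_le hA3le hA3nn hCR hCle hCnn hlamle hlamnn) hM hA3 hA3 hS hEU hG hCi

/-- **Lever 2 as a conditional frame: `K = 6` from the typed analytic inputs IF a pair-sieve constant
`C* ≤ 2.835` were available** (the `K = 6` row of Johnston–Trudgian's table, `C₁ = 2C* ≤ 5.672`): printed
lacunary constant `λ ≤ 0.789401`, mean square in the (C2def1) shape at level `N^{4/9 − 10⁻⁴}`,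
`C ≤ C₀R₀(C* − 1) + (5/9 + 10⁻⁴)(log 2)/2` with `C₀R₀ ≤ 1.2784422`. The best pair-sieve constants are `3.9171`
(Chen, print) and `3.3907` (Lichtman, preprint); nothing near `2.835` is known or claimed. Every analytic
input is a hypothesis; the theorem proves bookkeeping and `crit33_lt_one_of_Cstar_le` only.
[cite: JohnstonTrudgian2026, Theorem PRthm and Table PRtable (K = 6)] -/
theorem goldbach_linnik_six_of_analytic_inputs_of_Cstar_le {𝔐 E : ℕ → Set ℝ}
    (h𝔐 : ∀ N, MeasurableSet (𝔐 N)) (hE : ∀ N, MeasurableSet (E N)) {U : ℕ → ℝ}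
    {A₃ C C0R0 Cstar lam Cerr : ℝ} (hA3le : A₃ ≤ 0.013598) (hA3nn : 0 ≤ A₃)
    (hCR : C0R0 ≤ 1.2784422) (hCRnn : 0 ≤ C0R0) (hCs : Cstar ≤ 2.835)
    (hCle : C ≤ C0R0 * (Cstar - 1) + Real.log 2 / 2 * (5 / 9 + 1 / 10 ^ 4)) (hCnn : 0 ≤ C)
    (hlamle : lam ≤ 0.789401) (hlamnn : 0 ≤ lam)
    (hM : ∀ᶠ N : ℕ in atTop, ∀ m : ℤ, m ≠ 0 → Even m →
      majorArcPairIntegral (𝔐 N) N m ≤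
        goldbachSingularSeries m.natAbs * N / Real.log N ^ 2 + Cerr * N / Real.log N ^ 3)
    (hA3 : ∀ ε : ℝ, 0 < ε → ∀ᶠ N : ℕ in atTop,
      pairSingularSum N 3 ≤ (1 + A₃ + ε) * (2 * (powLen N : ℝ) ^ (2 * 3)))
    (hS : ∀ᶠ N : ℕ in atTop, ∀ α ∈ Set.Icc (0 : ℝ) 1 \ 𝔐 N, ‖primeSum N α‖ ≤ U N)
    (hEU : ∀ ε : ℝ, 0 < ε → ∀ᶠ N : ℕ in atTop,
      (volume (E N ∩ Set.Icc (0 : ℝ) 1)).toReal * U N ^ 2 ≤ ε * N / Real.log N ^ 2)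
    (hG : ∀ᶠ N : ℕ in atTop, ∀ α ∈ Set.Icc (0 : ℝ) 1 \ E N, ‖powSum N α‖ ≤ lam * powLen N)
    (hCi : ∀ ε : ℝ, 0 < ε → ∀ᶠ N : ℕ in atTop,
      ∫ α in Set.Icc (0 : ℝ) 1 \ 𝔐 N, ‖primeSum N α * powSum N α‖ ^ 2 ≤
        (C + ε) * (2 * N * (powLen N : ℝ) ^ 2 / Real.log N ^ 2)) :
    goldbach_linnik_with 6 :=
  goldbach_linnik_with_of_analytic_inputs (i := 3) (j := 3) (by norm_num) (by norm_num) h𝔐 hE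
    hA3nn hA3nn hCnn hlamnn
    (crit33_lt_one_of_Cstar_le hA3le hA3nn hCR hCRnn hCs hCle hCnn hlamle hlamnn) hM hA3 hA3 hS hEU hG hCi

/-! ### §3 The floor and the two levers on the ROBUST box (`C₀R₀ ≤ 1.280714`, `A(3) ≤ 0.0136`)

Erratum to §2 (18 Aug 2026).  The decimal `C₀R₀ < 1.2784421041`, i.e. `R₀ < 1.93656` (Platt–Trudgian 2015,
p. 55, and Johnston–Trudgian 2026 (R0bounds), both attributing it to Pintz 2006, Lemma 2″), used in the
hypothesis `hCR : C0R0 ≤ 1.2784422` of §2, is CONTRADICTED by a finite partial sum of Romanov's series of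
positive terms `R₀ = ∑_{2∤d} k(d)/ξ(d)`: the terms with `d ≤ 10⁷` already sum to `1.93661… > 1.93656`
(reproduction cell `papers/Parity/linnik-goldbach-7`, rigorous partial sums; hence `R₀ > 1.9366` and
`C₀R₀ > 1.2785`).  The §2 theorems remain valid as typed, but their intended instantiation — `C0R0 :=` the
true `C₀R₀`, with `C` the constant of Pintz–Ruzsa II, Lemma 5 — is unavailable.  This section re-poses the
floor and both levers on the box that IS certified in refereed print and is immune to the eighth decimal:
`C₀ ≤ 0.66016182` (Wrench 1961, `C₀ = 0.6601618158…`) and `R₀ < 1.94` (Khalfalah–Pintz, Corollary 1, quoted in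
Pintz–Ruzsa I (8.14): `1.936 < R₀ < 1.94`), whence `C₀R₀ ≤ 1.280714`; and `A(3) < 0.0136` (Pintz–Ruzsa I,
Theorem 4 (9.10)) — the box of `crit43_flat_robust_lt_one` in `GoldbachLinnikSeven.lean`.  Effect on the
numbers: the FLOOR is unchanged (`C* < 2.865` is needed even with `R₀ ≥ 1.936`: `crit33_needs_Cstar_lt_robust`);
lever 1 needs the hypothetical `λ ≤ 0.7334` (§2: `0.7337`) in the crude shape `C ≤ C₀R₀(C* − 1) + (log 2)/2`,
resp. `λ ≤ 0.7419` in the Lemma-5 / (C2def1) shape at level `N^{4/9 − 10⁻⁴}`; lever 2 needs the hypothetical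
`C* ≤ 2.833` (§2: `2.835`; Johnston–Trudgian's table: `C₁ = 2C* = 5.672`).  Nothing here is a claim that any
such `λ` or `C*` is available. -/

/-- **Floor, robust form.** As `crit33_needs_Cstar_lt`, with the lower bound `R₀ ≥ 1.936` of Pintz–Ruzsa I
(8.14) in place of `1.93642`: the `K = 6` criterion with `λ ≥ 0.789401`, any `A₃ ≥ 0`, `C₀ ≥ 0.66016`, level
`ϑ ≤ 4/9` and a mean-square constant `C ≥ C₀R₀(C* − 1) + (1 − ϑ)(log 2)/2` NEEDS a pair-sieve constant
`C* < 2.865` (indeed `< 2.8649`). [cite: PintzRuzsa2003, (8.14) and Corollary 2] -/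
theorem crit33_needs_Cstar_lt_robust {A₃ C lam C0 R0 Cstar ϑ : ℝ} (hA : 0 ≤ A₃) (hlam : 0.789401 ≤ lam)
    (hC0 : 0.66016 ≤ C0) (hR0 : 1.936 ≤ R0) (hϑ : ϑ ≤ 4 / 9) (hCs : 1 ≤ Cstar)
    (hC : C0 * R0 * (Cstar - 1) + Real.log 2 / 2 * (1 - ϑ) ≤ C)
    (h : (A₃ + C * lam ^ (2 * 3 - 2)) * (A₃ + C * lam ^ (2 * 3 - 2)) < 1) : Cstar < 2.865 := by
  have hC' : C < 2.576 := crit33_needs_C_lt hA hlam h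
  have hl : 0.6931471803 < Real.log 2 := Real.log_two_gt_d9
  have h1 : (0.66016 : ℝ) * 1.936 * (Cstar - 1) ≤ C0 * R0 * (Cstar - 1) := by
    have : (0.66016 : ℝ) * 1.936 ≤ C0 * R0 := mul_le_mul hC0 hR0 (by norm_num) (by linarith)
    exact mul_le_mul_of_nonneg_right this (by linarith)
  have h2 : (0.6931471803 : ℝ) / 2 * (5 / 9) ≤ Real.log 2 / 2 * (1 - ϑ) := by nlinarith
  nlinarith

/-- Lever 1, robust numerics (crude shape): with `A₃ ≤ 0.0136` (Pintz–Ruzsa I, Theorem 4 (9.10)), the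
flat-Lichtman mean-square constant `C ≤ C₀R₀(3.3907 − 1) + (log 2)/2` with `C₀R₀ ≤ 1.280714` (Wrench's `C₀`,
`R₀ < 1.94` of (8.14)), and a HYPOTHETICAL lacunary constant `λ ≤ 0.7334`, the `(3, 3)` criterion holds
(corner value `< 0.9997`). [cite: PintzRuzsa2003, Theorem 4 (9.10) and (8.14)] -/
theorem crit33_lt_one_of_lam_le_robust {A₃ C C0R0 lam : ℝ} (hA3le : A₃ ≤ 0.0136) (hA3nn : 0 ≤ A₃)
    (hCR : C0R0 ≤ 1.280714) (hCle : C ≤ C0R0 * ((3.3907 : ℝ) - 1) + Real.log 2 / 2) (hCnn : 0 ≤ C)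
    (hlamle : lam ≤ 0.7334) (hlamnn : 0 ≤ lam) :
    (A₃ + C * lam ^ (2 * 3 - 2)) * (A₃ + C * lam ^ (2 * 3 - 2)) < 1 := by
  have hl : Real.log 2 < 0.6931471808 := Real.log_two_lt_d9
  have hCle' : C ≤ 3.408377 := by nlinarith
  have hl4 : lam ^ 4 ≤ (0.7334 : ℝ) ^ 4 := pow_le_pow_left₀ hlamnn hlamle 4
  have hCl : C * lam ^ 4 ≤ (3.408377 : ℝ) * 0.7334 ^ 4 :=
    mul_le_mul hCle' hl4 (by positivity) (by norm_num)
  have hval : A₃ + C * lam ^ 4 < 1 := by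
    have : (0.0136 : ℝ) + (3.408377 : ℝ) * 0.7334 ^ 4 < 1 := by norm_num
    linarith
  have hnn : 0 ≤ A₃ + C * lam ^ 4 := by positivity
  have h4 : (2 * 3 - 2 : ℕ) = 4 := by norm_num
  rw [h4]
  exact mul_lt_one_of_nonneg_of_lt_one_left hnn hval hval.le

/-- Lever 1, robust numerics, in the Lemma-5 / (C2def1) shape at major-arc level `P = N^{4/9 − 10⁻⁴}`:
`C ≤ C₀R₀(3.3907 − 1) + (5/9 + 10⁻⁴)(log 2)/2`, `C₀R₀ ≤ 1.280714`, `A₃ ≤ 0.0136`, and a HYPOTHETICAL lacunary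
constant `λ ≤ 0.7419` give the `(3, 3)` criterion (corner value `< 0.9996`).  In print `λ = 0.7894` (measure
`N^{-3/5}`); `0.7778 = d(7/12)` would come with the preprint minor-arc exponent `19/24`; `0.7163` is the
GRH-strength value (measure `N^{-1/2}`). [cite: PintzRuzsa2003, Theorem 4 (9.10) and (8.14)] -/
theorem crit33_lt_one_of_lam_le_robust' {A₃ C C0R0 lam : ℝ} (hA3le : A₃ ≤ 0.0136) (hA3nn : 0 ≤ A₃)
    (hCR : C0R0 ≤ 1.280714)
    (hCle : C ≤ C0R0 * ((3.3907 : ℝ) - 1) + Real.log 2 / 2 * (5 / 9 + 1 / 10 ^ 4)) (hCnn : 0 ≤ C)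
    (hlamle : lam ≤ 0.7419) (hlamnn : 0 ≤ lam) :
    (A₃ + C * lam ^ (2 * 3 - 2)) * (A₃ + C * lam ^ (2 * 3 - 2)) < 1 := by
  have hl : Real.log 2 < 0.6931471808 := Real.log_two_lt_d9
  have hCle' : C ≤ 3.254379 := by nlinarith
  have hl4 : lam ^ 4 ≤ (0.7419 : ℝ) ^ 4 := pow_le_pow_left₀ hlamnn hlamle 4
  have hCl : C * lam ^ 4 ≤ (3.254379 : ℝ) * 0.7419 ^ 4 :=
    mul_le_mul hCle' hl4 (by positivity) (by norm_num)
  have hval : A₃ + C * lam ^ 4 < 1 := by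
    have : (0.0136 : ℝ) + (3.254379 : ℝ) * 0.7419 ^ 4 < 1 := by norm_num
    linarith
  have hnn : 0 ≤ A₃ + C * lam ^ 4 := by positivity
  have h4 : (2 * 3 - 2 : ℕ) = 4 := by norm_num
  rw [h4]
  exact mul_lt_one_of_nonneg_of_lt_one_left hnn hval hval.le

/-- Lever 2, robust numerics: with `A₃ ≤ 0.0136`, the printed lacunary constant `λ ≤ 0.789401`,
`C₀R₀ ≤ 1.280714`, and a HYPOTHETICAL pair-sieve constant `C* ≤ 2.833` in the Lemma-5 / (C2def1) shape at
level `P = N^{4/9 − 10⁻⁴}` (`C ≤ C₀R₀(C* − 1) + (5/9 + 10⁻⁴)(log 2)/2`), the `(3, 3)` criterion holds (corner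
value `0.99998… < 1`; `2.833` is the largest three-decimal value that passes on this box).  This certifies, with
inward rounding and the robust `R₀ < 1.94`, the `K = 6`, no-GRH entry `C₁ = 2C* = 5.672` of Johnston–Trudgian's
table (there computed with `R₀ < 1.93656`). [cite: JohnstonTrudgian2026, Table PRtable (K = 6, C₁ required 5.672)] -/
theorem crit33_lt_one_of_Cstar_le_robust {A₃ C C0R0 Cstar lam : ℝ} (hA3le : A₃ ≤ 0.0136) (hA3nn : 0 ≤ A₃)
    (hCR : C0R0 ≤ 1.280714) (hCRnn : 0 ≤ C0R0) (hCs : Cstar ≤ 2.833)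
    (hCle : C ≤ C0R0 * (Cstar - 1) + Real.log 2 / 2 * (5 / 9 + 1 / 10 ^ 4)) (hCnn : 0 ≤ C)
    (hlamle : lam ≤ 0.789401) (hlamnn : 0 ≤ lam) :
    (A₃ + C * lam ^ (2 * 3 - 2)) * (A₃ + C * lam ^ (2 * 3 - 2)) < 1 := by
  have hl : Real.log 2 < 0.6931471808 := Real.log_two_lt_d9
  have h1 : C0R0 * (Cstar - 1) ≤ 1.280714 * 1.833 := by
    have := mul_le_mul_of_nonneg_left (by linarith : Cstar - 1 ≤ 1.833) hCRnn
    nlinarith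
  have hCle' : C ≤ 2.540125 := by nlinarith
  have hl4 : lam ^ 4 ≤ (0.789401 : ℝ) ^ 4 := pow_le_pow_left₀ hlamnn hlamle 4
  have hCl : C * lam ^ 4 ≤ (2.540125 : ℝ) * 0.789401 ^ 4 :=
    mul_le_mul hCle' hl4 (by positivity) (by norm_num)
  have hval : A₃ + C * lam ^ 4 < 1 := by
    have : (0.0136 : ℝ) + (2.540125 : ℝ) * 0.789401 ^ 4 < 1 := by norm_num
    linarith
  have hnn : 0 ≤ A₃ + C * lam ^ 4 := by positivity
  have h4 : (2 * 3 - 2 : ℕ) = 4 := by norm_num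
  rw [h4]
  exact mul_lt_one_of_nonneg_of_lt_one_left hnn hval hval.le

/-- **Lever 1 as a conditional frame on the robust box: `K = 6` from the typed analytic inputs IF the
lacunary constant were `λ ≤ 0.7334`.**  Hypotheses exactly as in `goldbach_linnik_seven_of_analytic_inputs_robust`
(`A₃ ≤ 0.0136`, `C₀R₀ ≤ 1.280714`, flat-Lichtman constant in the crude Lemma-5 shape, abstract minor-arc sup
bound), at `(i, j) = (3, 3)`, except that `hG` carries the HYPOTHETICAL constant `λ ≤ 0.7334` (in print: `0.7894`;
nothing of the kind is known or claimed).  Every analytic input is a hypothesis; the theorem proves bookkeeping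
and `crit33_lt_one_of_lam_le_robust` only. [cite: PintzRuzsa2003, §10 (10.10)–(10.16), Lemma 13, Theorem 4 (9.10), (8.14)] -/
theorem goldbach_linnik_six_of_analytic_inputs_of_lam_le_robust {𝔐 E : ℕ → Set ℝ}
    (h𝔐 : ∀ N, MeasurableSet (𝔐 N)) (hE : ∀ N, MeasurableSet (E N)) {U : ℕ → ℝ}
    {A₃ C C0R0 lam Cerr : ℝ} (hA3le : A₃ ≤ 0.0136) (hA3nn : 0 ≤ A₃)
    (hCR : C0R0 ≤ 1.280714) (hCle : C ≤ C0R0 * ((3.3907 : ℝ) - 1) + Real.log 2 / 2)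
    (hCnn : 0 ≤ C) (hlamle : lam ≤ 0.7334) (hlamnn : 0 ≤ lam)
    (hM : ∀ᶠ N : ℕ in atTop, ∀ m : ℤ, m ≠ 0 → Even m →
      majorArcPairIntegral (𝔐 N) N m ≤
        goldbachSingularSeries m.natAbs * N / Real.log N ^ 2 + Cerr * N / Real.log N ^ 3)
    (hA3 : ∀ ε : ℝ, 0 < ε → ∀ᶠ N : ℕ in atTop,
      pairSingularSum N 3 ≤ (1 + A₃ + ε) * (2 * (powLen N : ℝ) ^ (2 * 3)))
    (hS : ∀ᶠ N : ℕ in atTop, ∀ α ∈ Set.Icc (0 : ℝ) 1 \ 𝔐 N, ‖primeSum N α‖ ≤ U N)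
    (hEU : ∀ ε : ℝ, 0 < ε → ∀ᶠ N : ℕ in atTop,
      (volume (E N ∩ Set.Icc (0 : ℝ) 1)).toReal * U N ^ 2 ≤ ε * N / Real.log N ^ 2)
    (hG : ∀ᶠ N : ℕ in atTop, ∀ α ∈ Set.Icc (0 : ℝ) 1 \ E N, ‖powSum N α‖ ≤ lam * powLen N)
    (hCi : ∀ ε : ℝ, 0 < ε → ∀ᶠ N : ℕ in atTop,
      ∫ α in Set.Icc (0 : ℝ) 1 \ 𝔐 N, ‖primeSum N α * powSum N α‖ ^ 2 ≤
        (C + ε) * (2 * N * (powLen N : ℝ) ^ 2 / Real.log N ^ 2)) :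
    goldbach_linnik_with 6 :=
  goldbach_linnik_with_of_analytic_inputs (i := 3) (j := 3) (by norm_num) (by norm_num) h𝔐 hE
    hA3nn hA3nn hCnn hlamnn
    (crit33_lt_one_of_lam_le_robust hA3le hA3nn hCR hCle hCnn hlamle hlamnn) hM hA3 hA3 hS hEU hG hCi

/-- **Lever 2 as a conditional frame on the robust box: `K = 6` from the typed analytic inputs IF a pair-sieve
constant `C* ≤ 2.833` were available** (the `K = 6` row of Johnston–Trudgian's table, `C₁ = 2C* ≤ 5.672`, on
the box `A₃ ≤ 0.0136`, `C₀R₀ ≤ 1.280714`): printed lacunary constant `λ ≤ 0.789401`, mean square in the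
(C2def1) shape at level `N^{4/9 − 10⁻⁴}`, `C ≤ C₀R₀(C* − 1) + (5/9 + 10⁻⁴)(log 2)/2`.  The best pair-sieve
constants are `3.9171` (Chen, print) and `3.3907` (Lichtman, preprint); nothing near `2.833` is known or claimed.
Every analytic input is a hypothesis; the theorem proves bookkeeping and `crit33_lt_one_of_Cstar_le_robust` only.
[cite: JohnstonTrudgian2026, Theorem PRthm and Table PRtable (K = 6)] -/
theorem goldbach_linnik_six_of_analytic_inputs_of_Cstar_le_robust {𝔐 E : ℕ → Set ℝ}
    (h𝔐 : ∀ N, MeasurableSet (𝔐 N)) (hE : ∀ N, MeasurableSet (E N)) {U : ℕ → ℝ}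
    {A₃ C C0R0 Cstar lam Cerr : ℝ} (hA3le : A₃ ≤ 0.0136) (hA3nn : 0 ≤ A₃)
    (hCR : C0R0 ≤ 1.280714) (hCRnn : 0 ≤ C0R0) (hCs : Cstar ≤ 2.833)
    (hCle : C ≤ C0R0 * (Cstar - 1) + Real.log 2 / 2 * (5 / 9 + 1 / 10 ^ 4)) (hCnn : 0 ≤ C)
    (hlamle : lam ≤ 0.789401) (hlamnn : 0 ≤ lam)
    (hM : ∀ᶠ N : ℕ in atTop, ∀ m : ℤ, m ≠ 0 → Even m →
      majorArcPairIntegral (𝔐 N) N m ≤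
        goldbachSingularSeries m.natAbs * N / Real.log N ^ 2 + Cerr * N / Real.log N ^ 3)
    (hA3 : ∀ ε : ℝ, 0 < ε → ∀ᶠ N : ℕ in atTop,
      pairSingularSum N 3 ≤ (1 + A₃ + ε) * (2 * (powLen N : ℝ) ^ (2 * 3)))
    (hS : ∀ᶠ N : ℕ in atTop, ∀ α ∈ Set.Icc (0 : ℝ) 1 \ 𝔐 N, ‖primeSum N α‖ ≤ U N)
    (hEU : ∀ ε : ℝ, 0 < ε → ∀ᶠ N : ℕ in atTop,
      (volume (E N ∩ Set.Icc (0 : ℝ) 1)).toReal * U N ^ 2 ≤ ε * N / Real.log N ^ 2)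
    (hG : ∀ᶠ N : ℕ in atTop, ∀ α ∈ Set.Icc (0 : ℝ) 1 \ E N, ‖powSum N α‖ ≤ lam * powLen N)
    (hCi : ∀ ε : ℝ, 0 < ε → ∀ᶠ N : ℕ in atTop,
      ∫ α in Set.Icc (0 : ℝ) 1 \ 𝔐 N, ‖primeSum N α * powSum N α‖ ^ 2 ≤
        (C + ε) * (2 * N * (powLen N : ℝ) ^ 2 / Real.log N ^ 2)) :
    goldbach_linnik_with 6 :=
  goldbach_linnik_with_of_analytic_inputs (i := 3) (j := 3) (by norm_num) (by norm_num) h𝔐 hE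
    hA3nn hA3nn hCnn hlamnn
    (crit33_lt_one_of_Cstar_le_robust hA3le hA3nn hCR hCRnn hCs hCle hCnn hlamle hlamnn)
    hM hA3 hA3 hS hEU hG hCi

end GoldbachLinnik

end Literature.NumberTheory.Sieve
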